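import Mathlib
import Summits.ResolutionOfSingularities.ResolutionOfSingularities.Theorems.WeightedInvariantDatumToEmbeddedQuotientSingularitiesGraded
import Summits.ResolutionOfSingularities.ResolutionOfSingularities.Theorems.WeightedInvariantDatumToEmbeddedQuotientSingularitiesGradedLocalization
import Summits.ResolutionOfSingularities.ResolutionOfSingularities.Theorems.WeightedInvariantDatumToEmbeddedQuotientSingularitiesLattice
import HarnessLib

/-!
# Slice theorem, step 1: making the homogeneous sections at a point units

Topic: `Summits/ResolutionOfSingularities/ResolutionOfSingularities/Theorems`. Helper file of the
stub `stub_qs_sliceCore` of the line `Sketch` of the crux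
`Theses.WeightedInvariant.DatumToEmbedded` (statement `stmt-ResolutionOfSingularities-0572`).

Setting: a commutative `k`-algebra `R = ⨁_{χ ∈ G} R_χ` graded by an abelian group `G` with a
homogeneous UNIT in every degree `e • χ` (`e ≥ 1`; a diagonalizable group acting with finite
stabilisers), and a prime `P` of `R`.

* `exists_mem_zero_notMem_dvd` — finitely many homogeneous elements `uₗ ∉ P` have a common
  multiple `h = ∏ₗ uₗ ^ e · wₗ⁻¹` of DEGREE `0` outside `P` (`wₗ` the unit of degree `e • deg uₗ`);
  so on the invariant basic open `D(h) ∋ P` of `Spec R` the `uₗ` become units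
  (Mathlib's `IsLocalization.Away.isUnit_of_dvd`) while the quotient `Spec R₀` is only replaced by its basic open
  `D(h)`.
* On the localisation `L = R[1/h]`, graded by `awayPiece` (sibling file
  `…QuotientSingularitiesGradedLocalization`): there are again homogeneous units in all degrees
  `e • χ` (`exists_isUnit_awayPiece`), and every homogeneous element whose degree is NOT in the
  lattice `M_P` of degrees carrying a homogeneous element outside `P` (sibling file
  `…QuotientSingularitiesLattice`) is killed by every ring map `L → K` killing `P`
  (`map_eq_zero_of_not_mem_degLattice`) — it vanishes along the orbit closure through `P`.
* `etale_quotient_of_isMaximal` — the residue field of a finite-type algebra over a perfect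
  field at a maximal ideal is a finite separable extension, i.e. an étale algebra (Zariski's
  lemma + perfectness), used for the base change `κ(P) ⊗ₖ -` in the slice construction.

Only Mathlib and the sibling helper files are used. [folklore: Luna's étale slice theorem for
diagonalizable group actions, Zariski-local form; cf. Alper–Hall–Rydh, *A Luna étale slice
theorem for algebraic stacks*, and Abramovich–Temkin–Włodarczyk on torus actions]
-/

-- the summit namespace repeats `ResolutionOfSingularities` by design (mandated namespace)
set_option linter.dupNamespace false

namespace Summit.ResolutionOfSingularities.ResolutionOfSingularities.Theorems.DatumToEmbedded.QuotientSingularities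

open DirectSum

/-! ## A degree-zero common multiple outside `P` -/

section Multiple

variable {k R G : Type*} [CommRing k] [CommRing R] [Algebra k R] [AddCommGroup G] [DecidableEq G]
  (𝓡 : G → Submodule k R) [GradedAlgebra 𝓡] {e : ℕ} (he : 0 < e)
  (hunit : ∀ χ : G, ∃ u ∈ 𝓡 (e • χ), IsUnit u)

include he hunit in
/-- **A degree-`0` common multiple outside `P`.** Finitely many homogeneous elements `uₗ ∉ P`
(`P` prime) divide some `h ∈ R₀ ∖ P`, namely `h = ∏ₗ uₗ ^ e · wₗ` with `wₗ` the (homogeneous)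
inverse of a unit of degree `e • deg uₗ`. [folklore] -/
theorem exists_mem_zero_notMem_dvd (P : Ideal R) [P.IsPrime] {m : ℕ} {d : Fin m → G}
    (u : Fin m → R) (hu : ∀ l, u l ∈ 𝓡 (d l)) (huP : ∀ l, u l ∉ P) :
    ∃ h ∈ 𝓡 0, h ∉ P ∧ ∀ l, u l ∣ h := by
  -- for each `l` a homogeneous inverse `w l` of a unit of degree `e • d l`
  have hw : ∀ l, ∃ w ∈ 𝓡 (-(e • d l)), IsUnit w := fun l => by
    obtain ⟨v, hv, hvu⟩ := hunit (d l)
    obtain ⟨w, hw, hvw, -⟩ := exists_inv_mem_of_isUnit 𝓡 hv hvu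
    exact ⟨w, hw, IsUnit.of_mul_eq_one_right v hvw⟩
  choose w hw hwu using hw
  have hl : ∀ l, u l ^ e * w l ∈ 𝓡 0 := fun l => by
    have h1 := SetLike.mul_mem_graded (SetLike.pow_mem_graded e (hu l)) (hw l)
    rwa [add_neg_cancel] at h1
  have hlP : ∀ l, u l ^ e * w l ∉ P := fun l h1 =>
    (Ideal.IsPrime.mem_or_mem ‹P.IsPrime› h1).elim
      (fun h2 => huP l (Ideal.IsPrime.mem_of_pow_mem ‹P.IsPrime› e h2))
      (fun h2 => Ideal.IsPrime.ne_top ‹P.IsPrime› (Ideal.eq_top_of_isUnit_mem _ h2 (hwu l)))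
  refine ⟨∏ l, u l ^ e * w l, ?_, ?_, fun l => ?_⟩
  · simpa using SetLike.prod_mem_graded 𝓡 (fun _ => (0 : G)) (fun l => u l ^ e * w l)
      (F := Finset.univ) fun l _ => hl l
  · refine Finset.prod_induction (fun l => u l ^ e * w l) (fun x => x ∉ P) ?_ ?_ fun l _ => hlP l
    · exact fun x y hx hy hxy => (Ideal.IsPrime.mem_or_mem ‹P.IsPrime› hxy).elim hx hy
    · exact (Ideal.ne_top_iff_one P).1 (Ideal.IsPrime.ne_top ‹P.IsPrime›)
  · exact (dvd_mul_of_dvd_left (dvd_pow_self (u l) he.ne') (w l)).trans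
      (Finset.dvd_prod_of_mem (fun l => u l ^ e * w l) (Finset.mem_univ l))

end Multiple

/-! ## The localisation away from a degree-zero element -/

section Localized

variable {k R G : Type*} [CommRing k] [CommRing R] [Algebra k R] [AddCommGroup G] [DecidableEq G]
  (𝓡 : G → Submodule k R) [GradedAlgebra 𝓡] {e : ℕ} (he : 0 < e)
  (hunit : ∀ χ : G, ∃ u ∈ 𝓡 (e • χ), IsUnit u) {h : R} (hh : h ∈ 𝓡 0)
  (L : Type*) [CommRing L] [Algebra R L] [Algebra k L] [IsScalarTower k R L]
  [IsLocalization.Away h L]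

include hunit in
omit [IsLocalization.Away h L] in
/-- `R[1/h]` again has **homogeneous units in all degrees `e • χ`**. [folklore] -/
theorem exists_isUnit_awayPiece (χ : G) :
    ∃ w ∈ awayPiece 𝓡 hh L (e • χ), IsUnit w := by
  obtain ⟨v, hv, hvu⟩ := hunit χ
  exact ⟨algebraMap R L v, algebraMap_mem_awayPiece hh hv, hvu.map _⟩

/-- **Homogeneous elements of `R[1/h]` of degree outside the lattice `M_P` die under every ring
map killing `P`**: if `hⁿ x = a / 1` with `a ∈ R_χ`, `χ ∉ M_P`, then `a ∈ P`, and `h` is a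
unit. [folklore] -/
theorem map_eq_zero_of_not_mem_degLattice (P : Ideal R) [P.IsPrime] {K : Type*} [CommRing K]
    (f : L →+* K) (hf : ∀ a ∈ P, f (algebraMap R L a) = 0) {χ : G}
    (hχ : χ ∉ degLattice 𝓡 he hunit P) {x : L} (hx : x ∈ awayPiece 𝓡 hh L χ) : f x = 0 := by
  obtain ⟨n, a, ha, hax⟩ := (mem_awayPiece_iff hh).1 hx
  have haP : a ∈ P := mem_of_not_mem_degLattice 𝓡 he hunit P P (fun _ _ => Iff.rfl) hχ ha
  have hu : IsUnit (f (algebraMap R L h ^ n)) :=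
    ((IsLocalization.Away.algebraMap_isUnit h).pow n).map f
  have h0 : f (algebraMap R L h ^ n) * f x = 0 := by rw [← map_mul, hax, hf a haP]
  exact hu.mul_right_eq_zero.1 h0

end Localized

/-! ## The residue field at a closed point is étale over a perfect field -/

section Residue

/-- Over a PERFECT field `k`, the residue field `R ⧸ P` of a finite-type `k`-algebra at a maximal
ideal is an **étale** `k`-algebra: it is finite over `k` (Zariski's lemma) and separable
(perfectness). [folklore] -/
theorem etale_quotient_of_isMaximal {k R : Type*} [Field k] [PerfectField k] [CommRing R]
    [Algebra k R] [Algebra.FiniteType k R] (P : Ideal R) [P.IsMaximal] :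
    letI := Ideal.Quotient.field P
    Algebra.Etale k (R ⧸ P) := by
  letI := Ideal.Quotient.field P
  haveI : Module.Finite k (R ⧸ P) := finite_of_finite_type_of_isJacobsonRing k (R ⧸ P)
  haveI : Algebra.IsSeparable k (R ⧸ P) := Algebra.IsAlgebraic.isSeparable_of_perfectField
  haveI : Algebra.FormallyEtale k (R ⧸ P) := Algebra.FormallyEtale.of_isSeparable k (R ⧸ P)
  haveI : Algebra.FinitePresentation k (R ⧸ P) :=
    (Algebra.FinitePresentation.of_finiteType (R := k) (A := R ⧸ P)).1 inferInstance
  exact Algebra.Etale.mk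

end Residue

/-! ## Registered form -/

/-- **Registered sub-goal `stub_qs_sliceUnits`** of the crux (helper of the stub
`stub_qs_sliceCore`): finitely many homogeneous elements outside a prime `P` of a graded algebra
with homogeneous units in all degrees `e • χ` have a degree-`0` common multiple outside `P`.
[folklore] -/
theorem stub_qs_sliceUnits :
    ∀ {k R G : Type} [CommRing k] [CommRing R] [Algebra k R] [AddCommGroup G] [DecidableEq G] (𝓡 : G
      → Submodule k R) [GradedAlgebra 𝓡] {e : ℕ}, 0 < e → (∀ χ : G, ∃ u ∈ 𝓡 (e • χ), IsUnit u) → ∀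
      (P : Ideal R) [P.IsPrime] {m : ℕ} {d : Fin m → G} (u : Fin m → R), (∀ l, u l ∈ 𝓡 (d l)) → (∀
      l, u l ∉ P) → ∃ h ∈ 𝓡 0, h ∉ P ∧ ∀ l, u l ∣ h := by
  intro k R G _ _ _ _ _ 𝓡 _ e he hunit P _ m d u hu huP
  exact exists_mem_zero_notMem_dvd 𝓡 he hunit P u hu huP

end Summit.ResolutionOfSingularities.ResolutionOfSingularities.Theorems.DatumToEmbedded.QuotientSingularities
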